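import Literature.Probability.RandomPlanarGeometry.RectilinearPolygonGrid
import Literature.Probability.LatticeModels.FKIsingQuadrilateralCrossing
import Literature.Probability.LatticeModels.DiscreteRectBoundaryLoop
import Literature.Probability.LatticeModels.HoleFreePotential
import Literature.Probability.LatticeModels.SquareTilingConjugate
import Literature.Probability.LatticeModels.MeshApproximatesPolyomino
import HarnessLib

/-!
# The polyomino of a rectilinear simple polygon at small mesh

Plane / lattice geometry ([folklore]) behind the comparison polyominoes of the Chelkak–Smirnov
crossing argument: for the Jordan domain `P = polygonDomain l h` of a simple closed polygon `l`
that is **rectilinear** (consecutive vertices share abscissa or ordinate) with grid gap `g`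
(`RectilinearPolygonGrid.lean`), and a mesh `δ` with `16 δ < g`, consider the set `F` of unit
squares `s` of `δℤ²` whose closed face `DiscreteRect.closedSq δ s` lies in `A = closure P`, and
the edge set `E` of all sides of squares of `F`. We prove:

* `DiscreteRect.mem_closedSq_iff` — the closed face is the coordinate box;
* local structure of `F`: squares between two `F`-squares of a short row / column are in `F`
  (`mem_of_row`, `mem_of_col`), and two `F`-squares in diagonal position have an `F`-square at
  one of the two remaining corners of their bounding box (`corner_mem_of_lt_of_lt`,
  `corner_mem_of_lt_of_gt`; pinch exclusion);
* consequences for `E`: faces of `E` are exactly the squares of `F` (`inF_iff`), `E` is induced,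
  has no pinch vertex and no diagonal contact, and vertices of `E` with a missing lattice edge
  are `2δ`-close to `∂P`;
* `F` is nonempty, covers the points of `P` at distance `≥ 2δ` from `∂P`, is side-connected
  (through `F`) and hole-free (`HoleFree`), for `δ` small;
* the packaged statement `exists_mesh_polyomino`.
-/

noncomputable section

open Set Complex Metric
open Literature.Probability.RandomPlanarGeometry

namespace Literature.Probability.LatticeModels

namespace DiscreteRect

/-! ### The closed face as a coordinate box -/

/-- The closed face `closedSq δ s` is the axis-parallel rectangle spanned by the corners `δ s`
and `δ (s + e₀ + e₁)`. [folklore] -/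
theorem closedSq_eq_rectangle (δ : ℝ) (s : Site 2) :
    closedSq δ s = Rectangle (meshPoint δ s) (meshPoint δ (s + dir 0 + dir 1)) := by
  rw [closedSq, rectangle_eq_convexHull]
  congr 1
  have e0 : meshPoint δ (corner s 0) = meshPoint δ s := by simp [corner]
  have e1 : meshPoint δ (corner s 1) =
      ((meshPoint δ (s + dir 0 + dir 1)).re : ℂ) + (meshPoint δ s).im * I := by
    apply Complex.ext <;> simp [corner, Pi.add_apply]
  have e2 : meshPoint δ (corner s 2) = meshPoint δ (s + dir 0 + dir 1) := by simp [corner]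
  have e3 : meshPoint δ (corner s 3) =
      ((meshPoint δ s).re : ℂ) + (meshPoint δ (s + dir 0 + dir 1)).im * I := by
    apply Complex.ext <;> simp [corner, Pi.add_apply]
  ext z
  simp only [mem_range, mem_insert_iff, mem_singleton_iff]
  constructor
  · rintro ⟨j, rfl⟩
    fin_cases j
    · exact Or.inl e0
    · exact Or.inr (Or.inr (Or.inl e1))
    · exact Or.inr (Or.inr (Or.inr e2))
    · exact Or.inr (Or.inl e3)
  · rintro (rfl | rfl | rfl | rfl)
    · exact ⟨0, e0⟩
    · exact ⟨3, e3⟩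
    · exact ⟨1, e1⟩
    · exact ⟨2, e2⟩

/-- **The closed face is the coordinate box** `[δ s₀, δ (s₀ + 1)] × [δ s₁, δ (s₁ + 1)]`
(`δ ≥ 0`). [folklore] -/
theorem mem_closedSq_iff {δ : ℝ} (hδ : 0 ≤ δ) {s : Site 2} {z : ℂ} :
    z ∈ closedSq δ s ↔
      δ * s 0 ≤ z.re ∧ z.re ≤ δ * (s 0 + 1) ∧ δ * s 1 ≤ z.im ∧ z.im ≤ δ * (s 1 + 1) := by
  rw [closedSq_eq_rectangle, Rectangle, mem_reProdIm, meshPoint_re, meshPoint_im, meshPoint_re,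
    meshPoint_im]
  have h0 : (((s + dir 0 + dir 1) 0 : ℤ) : ℝ) = s 0 + 1 := by simp [Pi.add_apply]
  have h1 : (((s + dir 0 + dir 1) 1 : ℤ) : ℝ) = s 1 + 1 := by simp [Pi.add_apply]
  rw [h0, h1, uIcc_of_le (by nlinarith), uIcc_of_le (by nlinarith), mem_Icc, mem_Icc, and_assoc]

/-- The closed face of `FKIsingQuadrilateralCrossing.lean` is the closed square of
`SquareTilingConjugate.lean` (`δ ≥ 0`). [folklore] -/
theorem closedSq_eq_squareTiling {δ : ℝ} (hδ : 0 ≤ δ) (s : Site 2) :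
    closedSq δ s = SquareTiling.closedSq δ s := by
  ext z
  rw [mem_closedSq_iff hδ]
  rfl

/-! ### Coordinates of the four squares at a vertex -/

/-- Coordinates of the square in the first quadrant at `x` (lower-left corner `x`). [folklore] -/
@[simp] theorem quad_zero_apply (x : Site 2) (i : Fin 2) : quad x 0 i = x i := by simp [quad]
/-- Coordinates of the square in the second quadrant at `x`. [folklore] -/
@[simp] theorem quad_one_apply_zero (x : Site 2) : quad x 1 0 = x 0 - 1 := by
  simp [quad, Pi.add_apply, sub_eq_add_neg]
/-- Coordinates of the square in the second quadrant at `x`. [folklore] -/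
@[simp] theorem quad_one_apply_one (x : Site 2) : quad x 1 1 = x 1 := by
  simp [quad, Pi.add_apply]
/-- Coordinates of the square in the third quadrant at `x`. [folklore] -/
@[simp] theorem quad_two_apply_zero (x : Site 2) : quad x 2 0 = x 0 - 1 := by
  simp [quad, Pi.add_apply, sub_eq_add_neg]
/-- Coordinates of the square in the third quadrant at `x`. [folklore] -/
@[simp] theorem quad_two_apply_one (x : Site 2) : quad x 2 1 = x 1 - 1 := by
  simp [quad, Pi.add_apply, sub_eq_add_neg]
/-- Coordinates of the square in the fourth quadrant at `x`. [folklore] -/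
@[simp] theorem quad_three_apply_zero (x : Site 2) : quad x 3 0 = x 0 := by
  simp [quad, Pi.add_apply]
/-- Coordinates of the square in the fourth quadrant at `x`. [folklore] -/
@[simp] theorem quad_three_apply_one (x : Site 2) : quad x 3 1 = x 1 - 1 := by
  simp [quad, Pi.add_apply, sub_eq_add_neg]

end DiscreteRect

namespace RectilinearPolyomino

open DiscreteRect

variable {l : List ℂ} (h : IsSimpleClosedPolygon l) {δ g : ℝ}
  (hrect : ∀ (k : ℕ) (hk : k < l.length),
    (l[k]).re = (l[(k + 1) % l.length]'(Nat.mod_lt _ h.pos)).re ∨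
    (l[k]).im = (l[(k + 1) % l.length]'(Nat.mod_lt _ h.pos)).im)
  (hgre : ∀ (i j : ℕ) (hi : i < l.length) (hj : j < l.length),
    |(l[i]).re - (l[j]).re| < g → (l[i]).re = (l[j]).re)
  (hgim : ∀ (i j : ℕ) (hi : i < l.length) (hj : j < l.length),
    |(l[i]).im - (l[j]).im| < g → (l[i]).im = (l[j]).im)
  (hδ : 0 < δ) {F : Finset (Site 2)}
  (hF : ∀ s, s ∈ F ↔ closedSq δ s ⊆ closure (polygonDomain l h).carrier)

/-! ### Point-level facts in plain coordinates (`σ = 1`, transposed, conjugated) -/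

include hrect hgre in
/-- `RectilinearPolygonGrid.mem_closure_of_between`, horizontal form. [folklore] -/
theorem between_re {p₀ p₁ z : ℂ} (hp₀ : p₀ ∈ closure (polygonDomain l h).carrier)
    (hp₁ : p₁ ∈ closure (polygonDomain l h).carrier) (h₀ : p₀.im = z.im) (h₁ : p₁.im = z.im)
    (hz : z.re ∈ uIcc p₀.re p₁.re) (hd : |p₀.re - p₁.re| < g) :
    z ∈ closure (polygonDomain l h).carrier :=
  h.mem_closure_of_between (ContinuousLinearEquiv.refl ℝ ℂ) hrect hgre hp₀ hp₁ h₀ h₁ hz hd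

include hrect hgim in
/-- `RectilinearPolygonGrid.mem_closure_of_between`, vertical form. [folklore] -/
theorem between_im {p₀ p₁ z : ℂ} (hp₀ : p₀ ∈ closure (polygonDomain l h).carrier)
    (hp₁ : p₁ ∈ closure (polygonDomain l h).carrier) (h₀ : p₀.re = z.re) (h₁ : p₁.re = z.re)
    (hz : z.im ∈ uIcc p₀.im p₁.im) (hd : |p₀.im - p₁.im| < g) :
    z ∈ closure (polygonDomain l h).carrier := by
  obtain ⟨τ, hτ⟩ := exists_swap_equiv
  refine h.mem_closure_of_between τ (g := g) (fun k hk ↦ ?_) (fun i j hi hj ↦ ?_) hp₀ hp₁ ?_ ?_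
    ?_ ?_
  · simpa only [hτ] using (hrect k hk).symm
  · simpa only [hτ] using hgim i j hi hj
  all_goals simpa only [hτ]

include hrect in
/-- `RectilinearPolygonGrid.probe`, horizontal form. [folklore] -/
theorem probe_re {p q : ℂ} (hp : p ∈ closure (polygonDomain l h).carrier)
    (hq : q ∉ closure (polygonDomain l h).carrier) (hpq : p.im = q.im) :
    ∃ (k : ℕ) (hk : k < l.length), (l[k]).re ∈ uIcc p.re q.re ∧ (l[k]).re ≠ q.re :=
  h.probe (ContinuousLinearEquiv.refl ℝ ℂ) hrect hp hq hpq

include hrect in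
/-- `RectilinearPolygonGrid.probe`, vertical form. [folklore] -/
theorem probe_im {p q : ℂ} (hp : p ∈ closure (polygonDomain l h).carrier)
    (hq : q ∉ closure (polygonDomain l h).carrier) (hpq : p.re = q.re) :
    ∃ (k : ℕ) (hk : k < l.length), (l[k]).im ∈ uIcc p.im q.im ∧ (l[k]).im ≠ q.im := by
  obtain ⟨τ, hτ⟩ := exists_swap_equiv
  have := h.probe τ (fun k hk ↦ by simpa only [hτ] using (hrect k hk).symm) hp hq
    (by simpa only [hτ])
  simpa only [hτ] using this

include hrect hgre hgim in
/-- `RectilinearPolygonGrid.pinch` in plain coordinates: `A` strictly NE and SW of the grid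
point, missing points on the closed W and E sides. [folklore] -/
theorem pinch_re (hg : 0 < g) {ξ υ : ℝ} (hξ : ∃ (i : ℕ) (hi : i < l.length), (l[i]).re = ξ)
    (hυ : ∃ (j : ℕ) (hj : j < l.length), (l[j]).im = υ) {p p' q q' : ℂ}
    (hp : p ∈ closure (polygonDomain l h).carrier) (hp1 : ξ < p.re) (hp2 : p.re < ξ + g)
    (hp3 : υ < p.im) (hp4 : p.im < υ + g)
    (hp' : p' ∈ closure (polygonDomain l h).carrier) (hp'1 : ξ - g < p'.re) (hp'2 : p'.re < ξ)
    (hp'3 : υ - g < p'.im) (hp'4 : p'.im < υ)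
    (hq : q ∉ closure (polygonDomain l h).carrier) (hq1 : ξ - g < q.re) (hq2 : q.re ≤ ξ)
    (hq3 : υ - g < q.im) (hq4 : q.im < υ + g)
    (hq' : q' ∉ closure (polygonDomain l h).carrier) (hq'1 : ξ ≤ q'.re) (hq'2 : q'.re < ξ + g)
    (hq'3 : υ - g < q'.im) (hq'4 : q'.im < υ + g) : False :=
  h.pinch (ContinuousLinearEquiv.refl ℝ ℂ) hrect hgre hgim hg hξ hυ hp hp1 hp2 hp3 hp4 hp' hp'1
    hp'2 hp'3 hp'4 hq hq1 hq2 hq3 hq4 hq' hq'1 hq'2 hq'3 hq'4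

include hrect hgre hgim in
/-- `RectilinearPolygonGrid.pinch` after complex conjugation: `A` strictly SE and NW of the grid
point, missing points on the closed W and E sides. [folklore] -/
theorem pinch_conj (hg : 0 < g) {ξ υ : ℝ} (hξ : ∃ (i : ℕ) (hi : i < l.length), (l[i]).re = ξ)
    (hυ : ∃ (j : ℕ) (hj : j < l.length), (l[j]).im = υ) {p p' q q' : ℂ}
    (hp : p ∈ closure (polygonDomain l h).carrier) (hp1 : ξ < p.re) (hp2 : p.re < ξ + g)
    (hp3 : υ - g < p.im) (hp4 : p.im < υ)
    (hp' : p' ∈ closure (polygonDomain l h).carrier) (hp'1 : ξ - g < p'.re) (hp'2 : p'.re < ξ)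
    (hp'3 : υ < p'.im) (hp'4 : p'.im < υ + g)
    (hq : q ∉ closure (polygonDomain l h).carrier) (hq1 : ξ - g < q.re) (hq2 : q.re ≤ ξ)
    (hq3 : υ - g < q.im) (hq4 : q.im < υ + g)
    (hq' : q' ∉ closure (polygonDomain l h).carrier) (hq'1 : ξ ≤ q'.re) (hq'2 : q'.re < ξ + g)
    (hq'3 : υ - g < q'.im) (hq'4 : q'.im < υ + g) : False := by
  obtain ⟨j, hj, hjυ⟩ := hυ
  refine h.pinch conjCLE (fun k hk ↦ ?_) (fun i i' hi hi' ↦ ?_) (fun i i' hi hi' ↦ ?_) hg hξ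
    (υ := -υ) ⟨j, hj, by simp [hjυ]⟩ hp ?_ ?_ ?_ ?_ hp' ?_ ?_ ?_ ?_ hq ?_ ?_ ?_ ?_ hq' ?_ ?_ ?_ ?_
  · simpa using hrect k hk
  · simpa using hgre i i' hi hi'
  · have := hgim i i' hi hi'
    simp only [conjCLE_apply, conj_im, neg_sub_neg, neg_inj]
    rwa [abs_sub_comm]
  all_goals simp only [conjCLE_apply, conj_re, conj_im]
  all_goals linarith

/-! ### Membership in `F` -/

include hδ hF in
/-- Points of the closed face of an `F`-square lie in `A = closure P`. [folklore] -/
theorem memA_of_mem {s : Site 2} (hs : s ∈ F) {z : ℂ} (h0 : δ * s 0 ≤ z.re)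
    (h0' : z.re ≤ δ * (s 0 + 1)) (h1 : δ * s 1 ≤ z.im) (h1' : z.im ≤ δ * (s 1 + 1)) :
    z ∈ closure (polygonDomain l h).carrier :=
  (hF s).1 hs ((mem_closedSq_iff hδ.le).2 ⟨h0, h0', h1, h1'⟩)

include hδ hF in
/-- A square whose closed face lies in `A` is in `F`. [folklore] -/
theorem mem_of_forall {s : Site 2}
    (H : ∀ z : ℂ, δ * s 0 ≤ z.re → z.re ≤ δ * (s 0 + 1) → δ * s 1 ≤ z.im → z.im ≤ δ * (s 1 + 1) →
      z ∈ closure (polygonDomain l h).carrier) : s ∈ F :=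
  (hF s).2 fun z hz ↦ by
    obtain ⟨h0, h0', h1, h1'⟩ := (mem_closedSq_iff hδ.le).1 hz
    exact H z h0 h0' h1 h1'

include hδ hF in
/-- A square off `F` has a point of its closed face off `A`. [folklore] -/
theorem exists_not_memA {s : Site 2} (hs : s ∉ F) :
    ∃ q : ℂ, (δ * s 0 ≤ q.re ∧ q.re ≤ δ * (s 0 + 1) ∧ δ * s 1 ≤ q.im ∧ q.im ≤ δ * (s 1 + 1)) ∧
      q ∉ closure (polygonDomain l h).carrier := by
  rw [hF, not_subset] at hs
  obtain ⟨q, hq, hqA⟩ := hs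
  exact ⟨q, (mem_closedSq_iff hδ.le).1 hq, hqA⟩

/-! ### Rows, columns and corners -/

include hrect hgre hδ hF in
/-- **Short rows are convex in `F`.** If `s, s' ∈ F` lie in the same row, `s` to the left, and
span (with the squares between) a width `< g`, every square between them is in `F`. [folklore] -/
theorem mem_of_row {s s' t : Site 2} (hs : s ∈ F) (hs' : s' ∈ F) (h1 : s' 1 = s 1)
    (ht1 : t 1 = s 1) (ht0 : s 0 ≤ t 0) (ht0' : t 0 ≤ s' 0)
    (hw : δ * ((s' 0 : ℝ) - s 0 + 1) < g) : t ∈ F := by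
  refine mem_of_forall h hδ hF fun z hz0 hz0' hz1 hz1' ↦ ?_
  have e1 : ((t 1 : ℤ) : ℝ) = s 1 := by exact_mod_cast ht1
  have e1' : ((s' 1 : ℤ) : ℝ) = s 1 := by exact_mod_cast h1
  have c0 : ((s 0 : ℤ) : ℝ) ≤ t 0 := by exact_mod_cast ht0
  have c0' : ((t 0 : ℤ) : ℝ) ≤ s' 0 := by exact_mod_cast ht0'
  rw [e1] at hz1 hz1'
  refine between_re h hrect hgre (p₀ := ⟨δ * s 0, z.im⟩) (p₁ := ⟨δ * (s' 0 + 1), z.im⟩)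
    (memA_of_mem h hδ hF hs le_rfl (by linarith) hz1 hz1')
    (memA_of_mem h hδ hF hs' (by show δ * (s' 0 : ℝ) ≤ δ * (s' 0 + 1); linarith) le_rfl
      (by rwa [e1']) (by rwa [e1'])) rfl rfl ?_ ?_
  · show z.re ∈ uIcc (δ * s 0) (δ * (s' 0 + 1))
    rw [uIcc_of_le (by nlinarith)]
    exact ⟨by nlinarith, by nlinarith⟩
  · show |δ * s 0 - δ * (s' 0 + 1)| < g
    rw [abs_sub_comm, abs_of_nonneg (by nlinarith)]
    linarith

include hrect hgim hδ hF in
/-- **Short columns are convex in `F`.** [folklore] -/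
theorem mem_of_col {s s' t : Site 2} (hs : s ∈ F) (hs' : s' ∈ F) (h0 : s' 0 = s 0)
    (ht0 : t 0 = s 0) (ht1 : s 1 ≤ t 1) (ht1' : t 1 ≤ s' 1)
    (hw : δ * ((s' 1 : ℝ) - s 1 + 1) < g) : t ∈ F := by
  refine mem_of_forall h hδ hF fun z hz0 hz0' hz1 hz1' ↦ ?_
  have e0 : ((t 0 : ℤ) : ℝ) = s 0 := by exact_mod_cast ht0
  have e0' : ((s' 0 : ℤ) : ℝ) = s 0 := by exact_mod_cast h0
  have c1 : ((s 1 : ℤ) : ℝ) ≤ t 1 := by exact_mod_cast ht1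
  have c1' : ((t 1 : ℤ) : ℝ) ≤ s' 1 := by exact_mod_cast ht1'
  rw [e0] at hz0 hz0'
  refine between_im h hrect hgim (p₀ := ⟨z.re, δ * s 1⟩) (p₁ := ⟨z.re, δ * (s' 1 + 1)⟩)
    (memA_of_mem h hδ hF hs hz0 hz0' le_rfl (by linarith))
    (memA_of_mem h hδ hF hs' (by rwa [e0']) (by rwa [e0'])
      (by show δ * (s' 1 : ℝ) ≤ δ * (s' 1 + 1); linarith) le_rfl) rfl rfl ?_ ?_
  · show z.im ∈ uIcc (δ * s 1) (δ * (s' 1 + 1))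
    rw [uIcc_of_le (by nlinarith)]
    exact ⟨by nlinarith, by nlinarith⟩
  · show |δ * s 1 - δ * (s' 1 + 1)| < g
    rw [abs_sub_comm, abs_of_nonneg (by nlinarith)]
    linarith

include hrect hgre hgim hδ hF in
/-- **Corner lemma, rising diagonal.** If `s, s' ∈ F` with `s` strictly SW of `s'` inside a
window of size `< g`, then the NW or the SE corner square of their bounding block is in `F`
(otherwise a point off `A` in each of them, three probes locating a grid point between, and the
pinch exclusion). [folklore] -/
theorem corner_mem_of_lt_of_lt (hg : 0 < g) {s s' : Site 2} (hs : s ∈ F) (hs' : s' ∈ F)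
    (h0 : s 0 < s' 0) (h1 : s 1 < s' 1)
    (hw0 : δ * ((s' 0 : ℝ) - s 0 + 2) < g) (hw1 : δ * ((s' 1 : ℝ) - s 1 + 2) < g) :
    (![s 0, s' 1] : Site 2) ∈ F ∨ (![s' 0, s 1] : Site 2) ∈ F := by
  by_contra hnot
  rw [not_or] at hnot
  obtain ⟨q, ⟨hq0, hq0', hq1, hq1'⟩, hqA⟩ := exists_not_memA h hδ hF hnot.1
  obtain ⟨q', ⟨hq'0, hq'0', hq'1, hq'1'⟩, hq'A⟩ := exists_not_memA h hδ hF hnot.2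
  simp only [Matrix.cons_val_zero, Matrix.cons_val_one] at hq0 hq0' hq1 hq1'
  simp only [Matrix.cons_val_zero, Matrix.cons_val_one] at hq'0 hq'0' hq'1 hq'1'
  have hc0 : (s 0 : ℝ) + 1 ≤ s' 0 := by exact_mod_cast h0
  have hc1 : (s 1 : ℝ) + 1 ≤ s' 1 := by exact_mod_cast h1
  have hm0 : δ * (s 0 : ℝ) + δ ≤ δ * s' 0 := by nlinarith
  have hm1 : δ * (s 1 : ℝ) + δ ≤ δ * s' 1 := by nlinarith
  -- probe 1: from `s'` leftwards to `q`
  obtain ⟨i, hi, hiI, hiq⟩ := probe_re h hrect (p := ⟨δ * (s' 0 + 1 / 2), q.im⟩)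
    (memA_of_mem h hδ hF hs' (by show _ ≤ δ * (s' 0 + 1 / 2); linarith)
      (by show δ * (s' 0 + 1 / 2) ≤ _; linarith) hq1 hq1') hqA rfl
  have hξ : q.re < (l[i]).re ∧ (l[i]).re ≤ δ * (s' 0 + 1 / 2) := by
    change (l[i]).re ∈ uIcc (δ * (s' 0 + 1 / 2)) q.re at hiI
    rw [mem_uIcc] at hiI
    rcases hiI with ⟨e1, e2⟩ | ⟨e1, e2⟩
    · exfalso
      linarith
    · exact ⟨lt_of_le_of_ne e1 (Ne.symm hiq), e2⟩
  -- probe 2: from `s` rightwards to `q'`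
  obtain ⟨i', hi', hi'I, hi'q⟩ := probe_re h hrect (p := ⟨δ * (s 0 + 1 / 2), q'.im⟩)
    (memA_of_mem h hδ hF hs (by show _ ≤ δ * (s 0 + 1 / 2); linarith)
      (by show δ * (s 0 + 1 / 2) ≤ _; linarith) hq'1 hq'1') hq'A rfl
  have hξ' : δ * (s 0 + 1 / 2) ≤ (l[i']).re ∧ (l[i']).re < q'.re := by
    change (l[i']).re ∈ uIcc (δ * (s 0 + 1 / 2)) q'.re at hi'I
    rw [mem_uIcc] at hi'I
    rcases hi'I with ⟨e1, e2⟩ | ⟨e1, e2⟩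
    · exact ⟨e1, lt_of_le_of_ne e2 hi'q⟩
    · exfalso
      linarith
  have hii' : (l[i]).re = (l[i']).re :=
    hgre i i' hi hi' (by rw [abs_lt]; constructor <;> linarith)
  -- probe 3: from `s` upwards to `q`
  obtain ⟨j, hj, hjI, hjq⟩ := probe_im h hrect (p := ⟨q.re, δ * (s 1 + 1 / 2)⟩)
    (memA_of_mem h hδ hF hs hq0 hq0' (by show _ ≤ δ * (s 1 + 1 / 2); linarith)
      (by show δ * (s 1 + 1 / 2) ≤ _; linarith)) hqA rfl
  have hυ : δ * (s 1 + 1 / 2) ≤ (l[j]).im ∧ (l[j]).im < q.im := by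
    change (l[j]).im ∈ uIcc (δ * (s 1 + 1 / 2)) q.im at hjI
    rw [mem_uIcc] at hjI
    rcases hjI with ⟨e1, e2⟩ | ⟨e1, e2⟩
    · exact ⟨e1, lt_of_le_of_ne e2 hjq⟩
    · exfalso
      linarith
  refine pinch_re h hrect hgre hgim hg ⟨i, hi, rfl⟩ ⟨j, hj, rfl⟩
    (p := ⟨δ * (s' 0 + 1), δ * (s' 1 + 1)⟩) (p' := ⟨δ * s 0, δ * s 1⟩)
    (memA_of_mem h hδ hF hs' (by show _ ≤ δ * (s' 0 + 1); linarith) le_rfl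
      (by show _ ≤ δ * (s' 1 + 1); linarith) le_rfl)
    ?_ ?_ ?_ ?_
    (memA_of_mem h hδ hF hs le_rfl (by show δ * (s 0 : ℝ) ≤ _; linarith) le_rfl
      (by show δ * (s 1 : ℝ) ≤ _; linarith))
    ?_ ?_ ?_ ?_ hqA ?_ hξ.1.le ?_ ?_ hq'A ?_ ?_ ?_ ?_
  all_goals try dsimp only
  all_goals linarith

include hrect hgre hgim hδ hF in
/-- **Corner lemma, falling diagonal.** If `s, s' ∈ F` with `s` strictly NW of `s'` inside a
window of size `< g`, then the SW or the NE corner square of their bounding block is in `F`.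
[folklore] -/
theorem corner_mem_of_lt_of_gt (hg : 0 < g) {s s' : Site 2} (hs : s ∈ F) (hs' : s' ∈ F)
    (h0 : s 0 < s' 0) (h1 : s' 1 < s 1)
    (hw0 : δ * ((s' 0 : ℝ) - s 0 + 2) < g) (hw1 : δ * ((s 1 : ℝ) - s' 1 + 2) < g) :
    (![s 0, s' 1] : Site 2) ∈ F ∨ (![s' 0, s 1] : Site 2) ∈ F := by
  by_contra hnot
  rw [not_or] at hnot
  obtain ⟨q, ⟨hq0, hq0', hq1, hq1'⟩, hqA⟩ := exists_not_memA h hδ hF hnot.1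
  obtain ⟨q', ⟨hq'0, hq'0', hq'1, hq'1'⟩, hq'A⟩ := exists_not_memA h hδ hF hnot.2
  simp only [Matrix.cons_val_zero, Matrix.cons_val_one] at hq0 hq0' hq1 hq1'
  simp only [Matrix.cons_val_zero, Matrix.cons_val_one] at hq'0 hq'0' hq'1 hq'1'
  have hc0 : (s 0 : ℝ) + 1 ≤ s' 0 := by exact_mod_cast h0
  have hc1 : (s' 1 : ℝ) + 1 ≤ s 1 := by exact_mod_cast h1
  have hm0 : δ * (s 0 : ℝ) + δ ≤ δ * s' 0 := by nlinarith
  have hm1 : δ * (s' 1 : ℝ) + δ ≤ δ * s 1 := by nlinarith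
  -- probe 1: from `s'` leftwards to `q` (same rows as `s'`)
  obtain ⟨i, hi, hiI, hiq⟩ := probe_re h hrect (p := ⟨δ * (s' 0 + 1 / 2), q.im⟩)
    (memA_of_mem h hδ hF hs' (by show _ ≤ δ * (s' 0 + 1 / 2); linarith)
      (by show δ * (s' 0 + 1 / 2) ≤ _; linarith) hq1 hq1') hqA rfl
  have hξ : q.re < (l[i]).re ∧ (l[i]).re ≤ δ * (s' 0 + 1 / 2) := by
    change (l[i]).re ∈ uIcc (δ * (s' 0 + 1 / 2)) q.re at hiI
    rw [mem_uIcc] at hiI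
    rcases hiI with ⟨e1, e2⟩ | ⟨e1, e2⟩
    · exfalso
      linarith
    · exact ⟨lt_of_le_of_ne e1 (Ne.symm hiq), e2⟩
  -- probe 2: from `s` rightwards to `q'` (same rows as `s`)
  obtain ⟨i', hi', hi'I, hi'q⟩ := probe_re h hrect (p := ⟨δ * (s 0 + 1 / 2), q'.im⟩)
    (memA_of_mem h hδ hF hs (by show _ ≤ δ * (s 0 + 1 / 2); linarith)
      (by show δ * (s 0 + 1 / 2) ≤ _; linarith) hq'1 hq'1') hq'A rfl
  have hξ' : δ * (s 0 + 1 / 2) ≤ (l[i']).re ∧ (l[i']).re < q'.re := by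
    change (l[i']).re ∈ uIcc (δ * (s 0 + 1 / 2)) q'.re at hi'I
    rw [mem_uIcc] at hi'I
    rcases hi'I with ⟨e1, e2⟩ | ⟨e1, e2⟩
    · exact ⟨e1, lt_of_le_of_ne e2 hi'q⟩
    · exfalso
      linarith
  have hii' : (l[i]).re = (l[i']).re :=
    hgre i i' hi hi' (by rw [abs_lt]; constructor <;> linarith)
  -- probe 3: from `s` downwards to `q` (same columns as `s`)
  obtain ⟨j, hj, hjI, hjq⟩ := probe_im h hrect (p := ⟨q.re, δ * (s 1 + 1 / 2)⟩)
    (memA_of_mem h hδ hF hs hq0 hq0' (by show _ ≤ δ * (s 1 + 1 / 2); linarith)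
      (by show δ * (s 1 + 1 / 2) ≤ _; linarith)) hqA rfl
  have hυ : q.im < (l[j]).im ∧ (l[j]).im ≤ δ * (s 1 + 1 / 2) := by
    change (l[j]).im ∈ uIcc (δ * (s 1 + 1 / 2)) q.im at hjI
    rw [mem_uIcc] at hjI
    rcases hjI with ⟨e1, e2⟩ | ⟨e1, e2⟩
    · exfalso
      linarith
    · exact ⟨lt_of_le_of_ne e1 (Ne.symm hjq), e2⟩
  refine pinch_conj h hrect hgre hgim hg ⟨i, hi, rfl⟩ ⟨j, hj, rfl⟩
    (p := ⟨δ * (s' 0 + 1), δ * s' 1⟩) (p' := ⟨δ * s 0, δ * (s 1 + 1)⟩)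
    (memA_of_mem h hδ hF hs' (by show _ ≤ δ * (s' 0 + 1); linarith) le_rfl le_rfl
      (by show δ * (s' 1 : ℝ) ≤ _; linarith))
    ?_ ?_ ?_ ?_
    (memA_of_mem h hδ hF hs le_rfl (by show δ * (s 0 : ℝ) ≤ _; linarith)
      (by show _ ≤ δ * (s 1 + 1); linarith) le_rfl)
    ?_ ?_ ?_ ?_ hqA ?_ hξ.1.le ?_ ?_ hq'A ?_ ?_ ?_ ?_
  all_goals try dsimp only
  all_goals linarith

/-! ### The edge set of all sides of squares of `F` -/

section Edges

variable {E : Finset (Sym2 (Site 2))}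
  (hE : ∀ e, e ∈ E ↔ ∃ s ∈ F, ∃ j : Fin 4, e = s(corner s j, corner s j + dir j))

include hE in
/-- A lattice edge is in `E` iff one of the two squares it borders is in `F`. [folklore] -/
theorem mem_E_iff {x : Site 2} {k : Fin 4} :
    s(x, x + dir k) ∈ E ↔ quad x k ∈ F ∨ quad x (k + 3) ∈ F := by
  have e33 : ∀ k : Fin 4, k + 3 + 3 = k + 2 := by decide
  have e31 : ∀ k : Fin 4, k + 3 + 1 = k := by decide
  have e23 : ∀ k : Fin 4, k + 2 + 3 = k + 1 := by decide
  rw [hE]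
  constructor
  · rintro ⟨s, hs, j, he⟩
    rcases Sym2.eq_iff.1 he with ⟨h1, h2⟩ | ⟨h1, h2⟩
    · have hjk : k = j := by
        refine dir_injective ?_
        rw [h1] at h2
        exact add_left_cancel h2
      subst hjk
      left
      rw [h1, quad_corner]
      exact hs
    · have hjk : k = j + 2 := by
        rw [← dir_add_dir_eq_zero_iff]
        rw [h1, add_assoc] at h2
        simpa using h2
      subst hjk
      right
      rw [e23, h1, ← corner_add_one, quad_corner]
      exact hs
  · rintro (hk | hk)
    · exact ⟨_, hk, k, by rw [corner_quad]⟩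
    · refine ⟨_, hk, k + 2, ?_⟩
      have hc : corner (quad x (k + 3)) (k + 2) = x + dir k := by
        have := corner_quad_add_three x (k + 3)
        rwa [e33, e31] at this
      rw [hc, dir_add_two, ← sub_eq_add_neg, add_sub_cancel_right, Sym2.eq_swap]

include hE in
/-- A lattice point is a vertex of `E` iff one of the four squares at it is in `F`.
[folklore] -/
theorem mem_verts_iff {x : Site 2} : x ∈ verts E ↔ ∃ k : Fin 4, quad x k ∈ F := by
  constructor
  · intro hx
    rw [verts, Finset.mem_biUnion] at hx
    obtain ⟨e, he, hxe⟩ := hx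
    obtain ⟨s, hs, j, rfl⟩ := (hE e).1 he
    simp only [endpts, Sym2.lift_mk, Finset.mem_insert, Finset.mem_singleton] at hxe
    rcases hxe with rfl | rfl
    · exact ⟨j, by rw [quad_corner]; exact hs⟩
    · exact ⟨j + 1, by rw [← corner_add_one, quad_corner]; exact hs⟩
  · rintro ⟨k, hk⟩
    have : s(x + dir k, x) ∈ E := by
      rw [Sym2.eq_swap]
      exact (mem_E_iff hE).2 (Or.inl hk)
    exact mem_verts_of_mem this

include hrect hgre hδ hF hE in
/-- **The faces of `E` are exactly the squares of `F`** (a square all of whose four neighbours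
are in `F` is in `F`, by `mem_of_row`; needs `3δ < g`). [folklore] -/
theorem inF_iff (hg3 : 3 * δ < g) {s : Site 2} : InF E s ↔ s ∈ F := by
  constructor
  · intro hs
    by_contra hsF
    have hnb : ∀ j : Fin 4, quad (corner s j) (j + 3) ∈ F := fun j ↦
      ((mem_E_iff hE).1 (hs j)).resolve_left (by rw [quad_corner]; exact hsF)
    have hR := hnb 1
    have hL := hnb 3
    simp only [Fin.isValue, Fin.reduceAdd] at hR hL
    refine hsF (mem_of_row h hrect hgre hδ hF hL hR ?_ ?_ ?_ ?_ ?_)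
    · simp [corner, quad_zero_apply, Pi.add_apply]
    · simp [corner, Pi.add_apply]
    · simp [corner, Pi.add_apply]
    · simp [corner, quad_zero_apply, Pi.add_apply]
    · simp only [corner, quad_zero_apply, quad_two_apply_zero, Fin.isValue, Matrix.cons_val_one,
        Matrix.cons_val, Pi.add_apply, dir_zero_apply_zero, dir_one_apply_zero]
      push_cast
      linarith
  · intro hs j
    exact (hE _).2 ⟨s, hs, j, rfl⟩

include hrect hgre hgim hδ hF in
/-- Induced edges, horizontal core: if some square at `x` and some square at `x + e₀` are in
`F`, one of the two squares on the edge `x, x + e₀` is in `F`. [folklore] -/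
theorem induced_zero (hg : 0 < g) (hg4 : 4 * δ < g) {x : Site 2} (hx : ∃ a, quad x a ∈ F)
    (hy : ∃ b, quad (x + dir 0) b ∈ F) : quad x 0 ∈ F ∨ quad x 3 ∈ F := by
  have fin_four_cases : ∀ k : Fin 4, k = 0 ∨ k = 1 ∨ k = 2 ∨ k = 3 := by decide
  by_contra hnot
  rw [not_or] at hnot
  obtain ⟨hUM, hLM⟩ := hnot
  have hrowU : quad x 1 ∈ F → quad (x + dir 0) 0 ∈ F → False := fun h1 h2 ↦
    hUM (mem_of_row h hrect hgre hδ hF (t := quad x 0) h1 h2 (by simp [quad_zero_apply, Pi.add_apply])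
      (by simp [quad_zero_apply]) (by simp [quad_zero_apply]) (by simp [quad_zero_apply, Pi.add_apply])
      (by simp [quad_zero_apply, Pi.add_apply]; linarith))
  have hrowL : quad x 2 ∈ F → quad (x + dir 0) 3 ∈ F → False := fun h1 h2 ↦
    hLM (mem_of_row h hrect hgre hδ hF (t := quad x 3) h1 h2 (by simp [Pi.add_apply])
      (by simp) (by simp) (by simp [Pi.add_apply]) (by simp [Pi.add_apply]; linarith))
  obtain ⟨a, ha⟩ := hx
  obtain ⟨b, hb⟩ := hy
  have eUM : quad (x + dir 0) 1 = quad x 0 := by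
    funext i; fin_cases i <;> simp [quad_zero_apply, Pi.add_apply]
  have eLM : quad (x + dir 0) 2 = quad x 3 := by
    funext i; fin_cases i <;> simp [Pi.add_apply]
  rcases fin_four_cases a with rfl | rfl | rfl | rfl
  · exact hUM ha
  · rcases fin_four_cases b with rfl | rfl | rfl | rfl
    · exact hrowU ha hb
    · exact hUM (eUM ▸ hb)
    · exact hLM (eLM ▸ hb)
    · rcases corner_mem_of_lt_of_gt h hrect hgre hgim hδ hF hg ha hb
        (by simp [Pi.add_apply]) (by simp [Pi.add_apply])
        (by simp [Pi.add_apply]; linarith) (by simp [Pi.add_apply]; linarith) with hc | hc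
      · refine hrowL ?_ hb
        convert hc using 1
        funext i; fin_cases i <;> simp [Pi.add_apply]
      · refine hrowU ha ?_
        convert hc using 1
        funext i; fin_cases i <;> simp [quad_zero_apply, Pi.add_apply]
  · rcases fin_four_cases b with rfl | rfl | rfl | rfl
    · rcases corner_mem_of_lt_of_lt h hrect hgre hgim hδ hF hg ha hb
        (by simp [quad_zero_apply, Pi.add_apply]) (by simp [quad_zero_apply, Pi.add_apply])
        (by simp [quad_zero_apply, Pi.add_apply]; linarith)
        (by simp [quad_zero_apply, Pi.add_apply]; linarith) with hc | hc
      · refine hrowU ?_ hb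
        convert hc using 1
        funext i; fin_cases i <;> simp [quad_zero_apply, Pi.add_apply]
      · refine hrowL ha ?_
        convert hc using 1
        funext i; fin_cases i <;> simp [quad_zero_apply, Pi.add_apply]
    · exact hUM (eUM ▸ hb)
    · exact hLM (eLM ▸ hb)
    · exact hrowL ha hb
  · exact hLM ha

include hrect hgre hgim hδ hF in
/-- Induced edges, vertical core. [folklore] -/
theorem induced_one (hg : 0 < g) (hg4 : 4 * δ < g) {x : Site 2} (hx : ∃ a, quad x a ∈ F)
    (hy : ∃ b, quad (x + dir 1) b ∈ F) : quad x 1 ∈ F ∨ quad x 0 ∈ F := by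
  have fin_four_cases : ∀ k : Fin 4, k = 0 ∨ k = 1 ∨ k = 2 ∨ k = 3 := by decide
  by_contra hnot
  rw [not_or] at hnot
  obtain ⟨hLM, hRM⟩ := hnot
  -- left column: `quad x 2` (below), `quad (x + e₁) 1` (above), `quad x 1` between;
  -- right column: `quad x 3`, `quad (x + e₁) 0`, `quad x 0` between
  have hcolL : quad x 2 ∈ F → quad (x + dir 1) 1 ∈ F → False := fun h1 h2 ↦
    hLM (mem_of_col h hrect hgim hδ hF (t := quad x 1) h1 h2 (by simp [Pi.add_apply])
      (by simp) (by simp) (by simp [Pi.add_apply]) (by simp [Pi.add_apply]; linarith))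
  have hcolR : quad x 3 ∈ F → quad (x + dir 1) 0 ∈ F → False := fun h1 h2 ↦
    hRM (mem_of_col h hrect hgim hδ hF (t := quad x 0) h1 h2 (by simp [quad_zero_apply, Pi.add_apply])
      (by simp [quad_zero_apply]) (by simp [quad_zero_apply]) (by simp [quad_zero_apply, Pi.add_apply])
      (by simp [quad_zero_apply, Pi.add_apply]; linarith))
  obtain ⟨a, ha⟩ := hx
  obtain ⟨b, hb⟩ := hy
  have eL : quad (x + dir 1) 2 = quad x 1 := by
    funext i; fin_cases i <;> simp [Pi.add_apply]
  have eR : quad (x + dir 1) 3 = quad x 0 := by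
    funext i; fin_cases i <;> simp [quad_zero_apply, Pi.add_apply]
  rcases fin_four_cases a with rfl | rfl | rfl | rfl
  · exact hRM ha
  · exact hLM ha
  · rcases fin_four_cases b with rfl | rfl | rfl | rfl
    · -- `quad x 2` (below left) and `quad (x + e₁) 0` (above right): rising diagonal
      rcases corner_mem_of_lt_of_lt h hrect hgre hgim hδ hF hg ha hb
        (by simp [quad_zero_apply, Pi.add_apply]) (by simp [quad_zero_apply, Pi.add_apply])
        (by simp [quad_zero_apply, Pi.add_apply]; linarith)
        (by simp [quad_zero_apply, Pi.add_apply]; linarith) with hc | hc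
      · refine hcolL ha ?_
        convert hc using 1
        funext i; fin_cases i <;> simp [quad_zero_apply, Pi.add_apply]
      · refine hcolR ?_ hb
        convert hc using 1
        funext i; fin_cases i <;> simp [quad_zero_apply, Pi.add_apply]
    · exact hcolL ha hb
    · exact hLM (eL ▸ hb)
    · exact hRM (eR ▸ hb)
  · rcases fin_four_cases b with rfl | rfl | rfl | rfl
    · exact hcolR ha hb
    · -- `quad (x + e₁) 1` (above left) and `quad x 3` (below right): falling diagonal
      rcases corner_mem_of_lt_of_gt h hrect hgre hgim hδ hF hg hb ha
        (by simp [Pi.add_apply]) (by simp [Pi.add_apply])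
        (by simp [Pi.add_apply]; linarith) (by simp [Pi.add_apply]; linarith) with hc | hc
      · refine hcolL ?_ hb
        convert hc using 1
        funext i; fin_cases i <;> simp [Pi.add_apply]
      · refine hcolR ha ?_
        convert hc using 1
        funext i; fin_cases i <;> simp [quad_zero_apply, Pi.add_apply]
    · exact hLM (eL ▸ hb)
    · exact hRM (eR ▸ hb)

include hrect hgre hgim hδ hF hE in
/-- **`E` is induced**: two lattice-adjacent vertices of `E` are joined by an edge of `E`.
[folklore] -/
theorem induced (hg : 0 < g) (hg4 : 4 * δ < g) {x : Site 2} (hx : x ∈ verts E) (k : Fin 4)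
    (hy : x + dir k ∈ verts E) : s(x, x + dir k) ∈ E := by
  have fin_four_cases : ∀ k : Fin 4, k = 0 ∨ k = 1 ∨ k = 2 ∨ k = 3 := by decide
  rw [mem_verts_iff hE] at hx hy
  rw [mem_E_iff hE]
  rcases fin_four_cases k with rfl | rfl | rfl | rfl
  · simpa using induced_zero h hrect hgre hgim hδ hF hg hg4 hx hy
  · simpa using induced_one h hrect hgre hgim hδ hF hg hg4 hx hy
  · -- direction `-e₀`: the horizontal core at `x - e₀`
    have e : x + dir 2 + dir 0 = x := by funext i; fin_cases i <;> simp [Pi.add_apply]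
    have := induced_zero h hrect hgre hgim hδ hF hg hg4 hy (by rw [e]; exact hx)
    -- quad (x + dir 2) 0 = quad x 1 = quad x (2 + 3); quad (x + dir 2) 3 = quad x 2
    have e1 : quad (x + dir 2) 0 = quad x (2 + 3) := by
      funext i; fin_cases i <;> simp [quad_zero_apply, Pi.add_apply, sub_eq_add_neg]
    have e2 : quad (x + dir 2) 3 = quad x 2 := by
      funext i; fin_cases i <;> simp [Pi.add_apply, sub_eq_add_neg]
    rw [e1, e2] at this
    exact this.symm
  · have e : x + dir 3 + dir 1 = x := by funext i; fin_cases i <;> simp [Pi.add_apply]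
    have := induced_one h hrect hgre hgim hδ hF hg hg4 hy (by rw [e]; exact hx)
    have e1 : quad (x + dir 3) 1 = quad x (3 + 3) := by
      funext i; fin_cases i <;> simp [Pi.add_apply, sub_eq_add_neg]
    have e2 : quad (x + dir 3) 0 = quad x 3 := by
      funext i; fin_cases i <;> simp [quad_zero_apply, Pi.add_apply, sub_eq_add_neg]
    rw [e1, e2] at this
    exact this.symm

include hrect hgre hgim hδ hF hE in
/-- **No pinch vertex**: faces in two opposite quadrants at a vertex force a face in one of the
two other quadrants. [folklore] -/
theorem noPinch (hg : 0 < g) (hg4 : 4 * δ < g) {x : Site 2} (k : Fin 4) (h1 : InF E (quad x k))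
    (h2 : InF E (quad x (k + 2))) : InF E (quad x (k + 1)) ∨ InF E (quad x (k + 3)) := by
  have fin_four_cases : ∀ k : Fin 4, k = 0 ∨ k = 1 ∨ k = 2 ∨ k = 3 := by decide
  have hg3 : 3 * δ < g := by linarith
  simp only [inF_iff h hrect hgre hδ hF hE hg3] at h1 h2 ⊢
  have core0 : ∀ y : Site 2, quad y 0 ∈ F → quad y 2 ∈ F → quad y 1 ∈ F ∨ quad y 3 ∈ F := by
    intro y hy0 hy2
    rcases corner_mem_of_lt_of_lt h hrect hgre hgim hδ hF hg hy2 hy0 (by simp [quad_zero_apply])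
      (by simp [quad_zero_apply]) (by simp [quad_zero_apply]; linarith) (by simp [quad_zero_apply]; linarith)
      with hc | hc
    · left
      convert hc using 1
      funext i; fin_cases i <;> simp [quad_zero_apply]
    · right
      convert hc using 1
      funext i; fin_cases i <;> simp [quad_zero_apply]
  have core1 : ∀ y : Site 2, quad y 1 ∈ F → quad y 3 ∈ F → quad y 2 ∈ F ∨ quad y 0 ∈ F := by
    intro y hy1 hy3
    rcases corner_mem_of_lt_of_gt h hrect hgre hgim hδ hF hg hy1 hy3 (by simp) (by simp)
      (by simp; linarith) (by simp; linarith) with hc | hc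
    · left
      convert hc using 1
      funext i; fin_cases i <;> simp
    · right
      convert hc using 1
      funext i; fin_cases i <;> simp [quad_zero_apply]
  rcases fin_four_cases k with rfl | rfl | rfl | rfl
  · simpa using core0 x h1 h2
  · simpa using core1 x h1 h2
  · simpa [or_comm] using core0 x (by simpa using h2) h1
  · simpa [or_comm] using core1 x (by simpa using h2) h1

include hrect hgre hgim hδ hF hE in
/-- **No diagonal contact**: if `x` and `x + e_k + e_{k+1}` are vertices of `E`, so is
`x + e_k` or `x + e_{k+1}`. [folklore] -/
theorem noDiagonal (hg : 0 < g) (hg4 : 4 * δ < g) {x : Site 2} (hx : x ∈ verts E) (k : Fin 4)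
    (hz : x + dir k + dir (k + 1) ∈ verts E) :
    x + dir k ∈ verts E ∨ x + dir (k + 1) ∈ verts E := by
  have fin_four_cases : ∀ k : Fin 4, k = 0 ∨ k = 1 ∨ k = 2 ∨ k = 3 := by decide
  simp only [mem_verts_iff hE] at hx hz ⊢
  by_contra hnot
  simp only [not_or, not_exists] at hnot
  obtain ⟨hn1, hn2⟩ := hnot
  have core0 : ∀ y : Site 2, (∃ a, quad y a ∈ F) → (∃ b, quad (y + dir 0 + dir 1) b ∈ F) →
      (∀ c, quad (y + dir 0) c ∉ F) → (∀ c, quad (y + dir 1) c ∉ F) → False := by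
    rintro y ⟨a, ha⟩ ⟨b, hb⟩ hc1 hc2
    have hSW : quad y 2 ∈ F := by
      rcases fin_four_cases a with rfl | rfl | rfl | rfl
      · refine absurd ha (by convert hc1 1 using 2; funext i; fin_cases i <;>
          simp [quad_zero_apply, Pi.add_apply])
      · refine absurd ha (by convert hc2 2 using 2; funext i; fin_cases i <;>
          simp [Pi.add_apply])
      · exact ha
      · refine absurd ha (by convert hc1 2 using 2; funext i; fin_cases i <;>
          simp [Pi.add_apply])
    have hNE : quad (y + dir 0 + dir 1) 0 ∈ F := by
      rcases fin_four_cases b with rfl | rfl | rfl | rfl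
      · exact hb
      · refine absurd hb (by convert hc2 0 using 2; funext i; fin_cases i <;>
          simp [quad_zero_apply, Pi.add_apply])
      · refine absurd hb (by convert hc1 1 using 2; funext i; fin_cases i <;>
          simp [Pi.add_apply])
      · refine absurd hb (by convert hc1 0 using 2; funext i; fin_cases i <;>
          simp [quad_zero_apply, Pi.add_apply])
    rcases corner_mem_of_lt_of_lt h hrect hgre hgim hδ hF hg hSW hNE
      (by simp [quad_zero_apply, Pi.add_apply]) (by simp [quad_zero_apply, Pi.add_apply])
      (by simp [quad_zero_apply, Pi.add_apply]; linarith)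
      (by simp [quad_zero_apply, Pi.add_apply]; linarith) with hc | hc
    · refine hc2 1 ?_
      convert hc using 1
      funext i; fin_cases i <;> simp [quad_zero_apply, Pi.add_apply]
    · refine hc1 3 ?_
      convert hc using 1
      funext i; fin_cases i <;> simp [quad_zero_apply, Pi.add_apply]
  have core1 : ∀ y : Site 2, (∃ a, quad y a ∈ F) → (∃ b, quad (y + dir 1 + dir 2) b ∈ F) →
      (∀ c, quad (y + dir 1) c ∉ F) → (∀ c, quad (y + dir 2) c ∉ F) → False := by
    rintro y ⟨a, ha⟩ ⟨b, hb⟩ hc1 hc2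
    have hSE : quad y 3 ∈ F := by
      rcases fin_four_cases a with rfl | rfl | rfl | rfl
      · refine absurd ha (by convert hc1 3 using 2; funext i; fin_cases i <;>
          simp [quad_zero_apply, Pi.add_apply])
      · refine absurd ha (by convert hc2 0 using 2; funext i; fin_cases i <;>
          simp [quad_zero_apply, Pi.add_apply, sub_eq_add_neg])
      · refine absurd ha (by convert hc2 3 using 2; funext i; fin_cases i <;>
          simp [Pi.add_apply, sub_eq_add_neg])
      · exact ha
    have hNW : quad (y + dir 1 + dir 2) 1 ∈ F := by
      rcases fin_four_cases b with rfl | rfl | rfl | rfl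
      · refine absurd hb (by convert hc1 1 using 2; funext i; fin_cases i <;>
          simp [quad_zero_apply, Pi.add_apply, sub_eq_add_neg])
      · exact hb
      · refine absurd hb (by convert hc2 1 using 2; funext i; fin_cases i <;>
          simp [Pi.add_apply, sub_eq_add_neg])
      · refine absurd hb (by convert hc2 0 using 2; funext i; fin_cases i <;>
          simp [quad_zero_apply, Pi.add_apply, sub_eq_add_neg])
    rcases corner_mem_of_lt_of_gt h hrect hgre hgim hδ hF hg hNW hSE
      (by simp [Pi.add_apply]) (by simp [Pi.add_apply])
      (by simp [Pi.add_apply]; linarith) (by simp [Pi.add_apply]; linarith) with hc | hc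
    · refine hc2 2 ?_
      convert hc using 1
      funext i; fin_cases i <;> simp [Pi.add_apply, sub_eq_add_neg]
    · refine hc1 0 ?_
      convert hc using 1
      funext i; fin_cases i <;> simp [quad_zero_apply, Pi.add_apply]
  rcases fin_four_cases k with rfl | rfl | rfl | rfl
  · exact core0 x hx (by simpa using hz) (by simpa using hn1) (by simpa using hn2)
  · exact core1 x hx (by simpa using hz) (by simpa using hn1) (by simpa using hn2)
  · have e0 : x + dir 2 + dir 3 + dir 0 + dir 1 = x := by
      funext i; fin_cases i <;> simp [Pi.add_apply]
    have e1 : x + dir 2 + dir 3 + dir 0 = x + dir 3 := by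
      funext i; fin_cases i <;> simp [Pi.add_apply]
    have e2 : x + dir 2 + dir 3 + dir 1 = x + dir 2 := by
      funext i; fin_cases i <;> simp [Pi.add_apply]
    refine core0 (x + dir 2 + dir 3) (by simpa using hz) (by rw [e0]; exact hx)
      (by rw [e1]; simpa using hn2) (by rw [e2]; simpa using hn1)
  · have e0 : x + dir 3 + dir 0 + dir 1 + dir 2 = x := by
      funext i; fin_cases i <;> simp [Pi.add_apply]
    have e1 : x + dir 3 + dir 0 + dir 1 = x + dir 0 := by
      funext i; fin_cases i <;> simp [Pi.add_apply]
    have e2 : x + dir 3 + dir 0 + dir 2 = x + dir 3 := by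
      funext i; fin_cases i <;> simp [Pi.add_apply]
    refine core1 (x + dir 3 + dir 0) (by simpa using hz) (by rw [e0]; exact hx)
      (by rw [e1]; simpa using hn2) (by rw [e2]; simpa using hn1)

include hδ hF hE in
/-- **Vertices with a missing lattice edge are `2δ`-close to `∂P`**: the mesh point of `x` is a
corner of an `F`-square (so lies in `A`) and of a non-`F`-square flanking the missing edge,
which has a point off `A`; the segment between them carries a frontier point. [folklore] -/
theorem infDist_meshPoint_le {x : Site 2} (hx : x ∈ verts E)
    (hk : ∃ k : Fin 4, s(x, x + dir k) ∉ E) :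
    infDist (meshPoint δ x) (frontier (polygonDomain l h).carrier) ≤ 2 * δ := by
  obtain ⟨a, ha⟩ := (mem_verts_iff hE).1 hx
  obtain ⟨k, hk⟩ := hk
  have hqk : quad x k ∉ F := fun hmem ↦ hk ((mem_E_iff hE).2 (Or.inl hmem))
  have hm_sq : ∀ b : Fin 4, meshPoint δ x ∈ closedSq δ (quad x b) := fun b ↦
    subset_convexHull ℝ _ ⟨b, by simp⟩
  have hmA : meshPoint δ x ∈ closure (polygonDomain l h).carrier := (hF _).1 ha (hm_sq a)
  obtain ⟨q, hq, hqA⟩ : ∃ q ∈ closedSq δ (quad x k),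
      q ∉ closure (polygonDomain l h).carrier := by
    have := hqk
    rw [hF, not_subset] at this
    exact this
  obtain ⟨f, hfs, hff⟩ := Polyomino.exists_mem_segment_mem_frontier isClosed_closure.isOpen_compl hqA
    (fun hm' ↦ hm' hmA)
  rw [frontier_compl] at hff
  have hfP : f ∈ frontier (polygonDomain l h).carrier := frontier_closure_subset hff
  have hfsq : f ∈ closedSq δ (quad x k) := (convex_convexHull ℝ _).segment_subset hq (hm_sq k) hfs
  calc infDist (meshPoint δ x) (frontier (polygonDomain l h).carrier)
      ≤ dist (meshPoint δ x) f := infDist_le_dist_of_mem hfP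
    _ ≤ 2 * δ := by
      obtain ⟨f0, f0', f1, f1'⟩ := (mem_closedSq_iff hδ.le).1 hfsq
      obtain ⟨m0, m0', m1, m1'⟩ := (mem_closedSq_iff hδ.le).1 (hm_sq k)
      rw [Complex.dist_eq]
      refine (norm_le_abs_re_add_abs_im _).trans ?_
      rw [sub_re, sub_im]
      have h1 : |(meshPoint δ x).re - f.re| ≤ δ := abs_sub_le_iff.2 ⟨by linarith, by linarith⟩
      have h2 : |(meshPoint δ x).im - f.im| ≤ δ := abs_sub_le_iff.2 ⟨by linarith, by linarith⟩
      linarith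

end Edges

/-! ### Covering the `2δ`-interior -/

include hδ hF in
/-- **Covering.** A point of `P` at distance `≥ 2δ` from `∂P` lies in the closed face of an
`F`-square: the face of its floor square has diameter `√2 δ < 2δ`, so lies in the open ball of
radius `infDist z ∂P` about `z`, a connected set meeting `P` and missing `∂P`, hence inside `P`.
[folklore] -/
theorem exists_mem_closedSq {z : ℂ} (hz : z ∈ (polygonDomain l h).carrier)
    (hd : 2 * δ ≤ infDist z (frontier (polygonDomain l h).carrier)) :
    ∃ s ∈ F, z ∈ closedSq δ s := by
  obtain ⟨hz0, hz0', hz1, hz1'⟩ := SquareTiling.mem_closedSq_floorSq hδ z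
  refine ⟨SquareTiling.floorSq δ z, ?_, ?_⟩
  · refine mem_of_forall h hδ hF fun w hw0 hw0' hw1 hw1' ↦ subset_closure ?_
    have hdist : dist w z < 2 * δ := by
      rw [Complex.dist_eq]
      refine (norm_le_sqrt_two_mul_max _).trans_lt ?_
      rw [sub_re, sub_im]
      have h1 : |w.re - z.re| ≤ δ := abs_sub_le_iff.2 ⟨by linarith, by linarith⟩
      have h2 : |w.im - z.im| ≤ δ := abs_sub_le_iff.2 ⟨by linarith, by linarith⟩
      have hmax : max |w.re - z.re| |w.im - z.im| ≤ δ := max_le h1 h2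
      have hs2 : Real.sqrt 2 < 2 := by
        nlinarith [Real.sq_sqrt (show (0 : ℝ) ≤ 2 by norm_num), Real.sqrt_nonneg 2]
      calc Real.sqrt 2 * max |w.re - z.re| |w.im - z.im| ≤ Real.sqrt 2 * δ :=
            mul_le_mul_of_nonneg_left hmax (Real.sqrt_nonneg 2)
        _ < 2 * δ := mul_lt_mul_of_pos_right hs2 hδ
    have hball : ball z (infDist z (frontier (polygonDomain l h).carrier)) ⊆
        (polygonDomain l h).carrier :=
      subset_of_disjoint_frontier (convex_ball z _).isPreconnected (polygonDomain l h).isOpen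
        disjoint_ball_infDist ⟨z, mem_ball_self (by linarith), hz⟩
    exact hball (mem_ball.2 (by linarith))
  · rw [closedSq_eq_squareTiling hδ.le]
    exact ⟨hz0, hz0', hz1, hz1'⟩

/-! ### Hole-freeness -/

/-- A walk of squares off a set of faces is a chain of face steps avoiding it. [folklore] -/
theorem reflTransGen_faceStep_of_walk {P : Set (Site 2)} :
    ∀ {u v : Site 2} (ω : (zdGraph 2).Walk u v), (∀ x ∈ ω.support, x ∉ P) →
      Relation.ReflTransGen (FaceStep P) u v
  | _, _, SimpleGraph.Walk.nil, _ => Relation.ReflTransGen.refl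
  | u, _, SimpleGraph.Walk.cons (v := w) hadj ω', hs => by
    have hu : u ∉ P := hs u (SimpleGraph.Walk.start_mem_support _)
    have hs' : ∀ x ∈ ω'.support, x ∉ P := fun x hx ↦ hs x (by simp [hx])
    have hw : w ∉ P := hs' w (SimpleGraph.Walk.start_mem_support _)
    exact Relation.ReflTransGen.head ⟨hadj, hu, hw⟩ (reflTransGen_faceStep_of_walk ω' hs')

include hδ hF in
/-- **`F` is hole-free.** A square off `F` has a point of its face in the exterior
`(closure P)ᶜ`, which is open, connected (Jordan curve theorem) and contains every far point; a
path in the exterior to a point far up is shadowed by a walk of squares each containing an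
exterior point (`SquareTiling.exists_dualWalk_of_path`), hence off `F`. [folklore] -/
theorem holeFree : HoleFree (↑F : Set (Site 2)) := by
  intro g₀ hg₀ M
  rw [Finset.mem_coe] at hg₀
  obtain ⟨q, ⟨hq0, hq0', hq1, hq1'⟩, hqA⟩ := exists_not_memA h hδ hF hg₀
  obtain ⟨R, hR⟩ := (isBounded_iff_subset_closedBall 0).1 (polygonDomain l h).isBounded.closure
  set T : ℝ := max (|R| + 1) (δ * M) with hT
  have hyA : (⟨0, T⟩ : ℂ) ∉ closure (polygonDomain l h).carrier := by
    intro hyA'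
    have h0 := hR hyA'
    rw [mem_closedBall, dist_zero_right] at h0
    have h1 : |(⟨0, T⟩ : ℂ).im| ≤ ‖(⟨0, T⟩ : ℂ)‖ := abs_im_le_norm _
    have h2 : T ≤ |(⟨0, T⟩ : ℂ).im| := le_abs_self T
    have h3 : |R| + 1 ≤ T := le_max_left _ _
    linarith [le_abs_self R]
  obtain ⟨γ, hγ⟩ := Literature.Topology.PlaneTopology.joinedIn_of_isPreconnected
    (polygonDomain l h).isOpen_exterior
    (polygonDomain l h).isConnected_exterior.isPreconnected subset_rfl hqA hyA
  obtain ⟨ω, -, hsupp⟩ := SquareTiling.exists_dualWalk_of_path hδ zero_le_one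
    γ.continuous_extend.continuousOn (P := g₀) (P' := SquareTiling.floorSq δ ⟨0, T⟩)
    (by rw [γ.extend_zero]; exact ⟨hq0, hq0', hq1, hq1'⟩)
    (by rw [γ.extend_one]; exact SquareTiling.mem_closedSq_floorSq hδ _)
  refine ⟨SquareTiling.floorSq δ ⟨0, T⟩, ?_, reflTransGen_faceStep_of_walk ω fun x hx hxF ↦ ?_⟩
  · show M ≤ ⌊T / δ⌋
    rw [Int.le_floor, le_div_iff₀ hδ]
    linarith [le_max_right (|R| + 1) (δ * M), mul_comm δ (M : ℝ)]
  · obtain ⟨t, ht, hxt⟩ := hsupp x hx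
    rw [Finset.mem_coe] at hxF
    have hA := (hF x).1 hxF
    rw [closedSq_eq_squareTiling hδ.le] at hA
    have hmem := hA hxt
    rw [Path.extend_apply γ ht] at hmem
    exact hγ ⟨t, ht⟩ hmem

/-! ### Squares of `F` near every point of `A` -/

omit h in
/-- Fitting a lattice interval `[δ a, δ (a + 1)]` strictly inside an interval of length `> 4δ`,
within `2δ` of a given point of it. [folklore] -/
theorem exists_int_near (hδ : 0 < δ) {lo hi t : ℝ} (hlo : lo ≤ t) (hhi : t ≤ hi)
    (hw : 4 * δ < hi - lo) : ∃ a : ℤ, lo < δ * a ∧ δ * (a + 1) < hi ∧ |δ * a - t| ≤ 2 * δ := by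
  have h1 := Int.floor_le (t / δ)
  have h2 := Int.lt_floor_add_one (t / δ)
  have h3 := Int.le_ceil (t / δ)
  have h4 := Int.ceil_lt_add_one (t / δ)
  rw [le_div_iff₀ hδ] at h1
  rw [div_lt_iff₀ hδ] at h2
  rw [div_le_iff₀ hδ] at h3
  have h4' : (⌈t / δ⌉ : ℝ) * δ < t + δ := by
    have := mul_lt_mul_of_pos_right h4 hδ
    rwa [add_mul, div_mul_cancel₀ _ hδ.ne', one_mul] at this
  by_cases hup : t + 2 * δ < hi
  · refine ⟨⌊t / δ⌋ + 1, ?_, ?_, ?_⟩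
    · push_cast
      linarith
    · push_cast
      linarith
    · rw [abs_le]
      push_cast
      constructor <;> linarith
  · push Not at hup
    refine ⟨⌈t / δ⌉ - 2, ?_, ?_, ?_⟩
    · push_cast
      linarith
    · push_cast
      linarith
    · rw [abs_le]
      push_cast
      constructor <;> linarith

include hrect hgre hgim hδ hF in
/-- **Every point of `A` is `3δ`-close to an `F`-square** (`16 δ < g`). Near `z` the vertex
lines form at most a cross (`exists_local_center` on both axes), whose open quadrant boxes are
inside `P` or outside `A` (`box_subset_or_subset`); a point of `P` close to `z` off the two
lines (they have empty interior) lies in an inside quadrant, which has room `≥ g / 4 > 4δ` for a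
lattice square near `z`. [folklore] -/
theorem exists_mem_near (hg : 0 < g) (hδg : 16 * δ < g) {z : ℂ}
    (hz : z ∈ closure (polygonDomain l h).carrier) :
    ∃ s ∈ F, |δ * s 0 - z.re| ≤ 3 * δ ∧ |δ * s 1 - z.im| ≤ 3 * δ := by
  haveI : Nonempty (Fin l.length) := ⟨⟨0, h.pos⟩⟩
  obtain ⟨ξ, rx, hrx, hXfree⟩ := exists_local_center (fun k : Fin l.length ↦ (l[(k : ℕ)]).re) hg
    (fun i j hij ↦ hgre i j i.2 j.2 hij) z.re
  obtain ⟨υ, ry, hry, hYfree⟩ := exists_local_center (fun k : Fin l.length ↦ (l[(k : ℕ)]).im) hg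
    (fun i j hij ↦ hgim i j i.2 j.2 hij) z.im
  -- a point of `P` near `z` off the two lines
  obtain ⟨p, hpP, hpre, hpim, hpz⟩ : ∃ p ∈ (polygonDomain l h).carrier,
      p.re ≠ ξ ∧ p.im ≠ υ ∧ dist p z < δ := by
    have hU : IsOpen ((polygonDomain l h).carrier ∩ ball z δ) :=
      (polygonDomain l h).isOpen.inter isOpen_ball
    have hUne : ((polygonDomain l h).carrier ∩ ball z δ).Nonempty := by
      obtain ⟨p, hp, hpd⟩ := Metric.mem_closure_iff.1 hz δ hδ
      exact ⟨p, hp, mem_ball.2 (by rwa [dist_comm])⟩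
    have hL : interior ({w : ℂ | w.re = ξ} ∪ {w : ℂ | w.im = υ}) = ∅ := by
      have h1 : interior {w : ℂ | w.re = ξ} = ∅ := by
        rw [← frontier_setOf_re_le, interior_frontier (isClosed_le continuous_re continuous_const)]
      have h2 : interior {w : ℂ | w.im = υ} = ∅ := by
        rw [← frontier_setOf_im_le, interior_frontier (isClosed_le continuous_im continuous_const)]
      rw [interior_union_isClosed_of_interior_empty (isClosed_eq continuous_re continuous_const) h2,
        h1]
    have hnot :
        ¬ ((polygonDomain l h).carrier ∩ ball z δ ⊆ {w : ℂ | w.re = ξ} ∪ {w : ℂ | w.im = υ}) :=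
      fun hsub ↦ by
        have := interior_maximal hsub hU
        rw [hL, subset_empty_iff] at this
        exact hUne.ne_empty this
    obtain ⟨p, ⟨hpP, hpb⟩, hpL⟩ := not_subset.1 hnot
    simp only [mem_union, mem_setOf_eq, not_or] at hpL
    exact ⟨p, hpP, hpL.1, hpL.2, mem_ball.1 hpb⟩
  have hnorm := hpz
  rw [Complex.dist_eq] at hnorm
  have hpre' : |p.re - z.re| < δ := by
    have := abs_re_le_norm (p - z); rw [sub_re] at this; linarith
  have hpim' : |p.im - z.im| < δ := by
    have := abs_im_le_norm (p - z); rw [sub_im] at this; linarith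
  have hδ4 : 4 * δ < g / 4 := by linarith
  -- the side of `ξ` containing `p`, with a target abscissa `t₁` near `z.re`
  obtain ⟨lo₁, hi₁, hfree₁, hlo₁, hhi₁, t₁, ht₁lo, ht₁hi, ht₁z, hw₁⟩ :
      ∃ lo hi : ℝ, (∀ (i : ℕ) (hi' : i < l.length), (l[i]).re ∉ Ioo lo hi) ∧ lo < p.re ∧
        p.re < hi ∧ ∃ t, lo ≤ t ∧ t ≤ hi ∧ |t - z.re| ≤ δ ∧ 4 * δ < hi - lo := by
    have hzξ := abs_le.1 (show |z.re - ξ| ≤ rx - g / 4 by linarith)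
    have hpz' := abs_lt.1 hpre'
    rcases lt_or_gt_of_ne hpre with hlt | hgt
    · refine ⟨ξ - rx, ξ, fun i hi' ↦ (hXfree ⟨i, hi'⟩).1, by linarith, hlt, min z.re ξ,
        le_min (by linarith) (by linarith), min_le_right _ _, ?_, by linarith⟩
      rcases le_total z.re ξ with hzx | hzx
      · rw [min_eq_left hzx, sub_self, abs_zero]
        exact hδ.le
      · rw [min_eq_right hzx, abs_le]
        constructor <;> linarith
    · refine ⟨ξ, ξ + rx, fun i hi' ↦ (hXfree ⟨i, hi'⟩).2, hgt, by linarith, max z.re ξ,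
        le_max_right _ _, max_le (by linarith) (by linarith), ?_, by linarith⟩
      rcases le_total z.re ξ with hzx | hzx
      · rw [max_eq_right hzx, abs_le]
        constructor <;> linarith
      · rw [max_eq_left hzx, sub_self, abs_zero]
        exact hδ.le
  obtain ⟨lo₂, hi₂, hfree₂, hlo₂, hhi₂, t₂, ht₂lo, ht₂hi, ht₂z, hw₂⟩ :
      ∃ lo hi : ℝ, (∀ (i : ℕ) (hi' : i < l.length), (l[i]).im ∉ Ioo lo hi) ∧ lo < p.im ∧
        p.im < hi ∧ ∃ t, lo ≤ t ∧ t ≤ hi ∧ |t - z.im| ≤ δ ∧ 4 * δ < hi - lo := by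
    have hzυ := abs_le.1 (show |z.im - υ| ≤ ry - g / 4 by linarith)
    have hpz' := abs_lt.1 hpim'
    rcases lt_or_gt_of_ne hpim with hlt | hgt
    · refine ⟨υ - ry, υ, fun i hi' ↦ (hYfree ⟨i, hi'⟩).1, by linarith, hlt, min z.im υ,
        le_min (by linarith) (by linarith), min_le_right _ _, ?_, by linarith⟩
      rcases le_total z.im υ with hzx | hzx
      · rw [min_eq_left hzx, sub_self, abs_zero]
        exact hδ.le
      · rw [min_eq_right hzx, abs_le]
        constructor <;> linarith
    · refine ⟨υ, υ + ry, fun i hi' ↦ (hYfree ⟨i, hi'⟩).2, hgt, by linarith, max z.im υ,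
        le_max_right _ _, max_le (by linarith) (by linarith), ?_, by linarith⟩
      rcases le_total z.im υ with hzx | hzx
      · rw [max_eq_right hzx, abs_le]
        constructor <;> linarith
      · rw [max_eq_left hzx, sub_self, abs_zero]
        exact hδ.le
  -- the open box `(lo₁, hi₁) × (lo₂, hi₂)` meets `P` at `p`, so lies inside `P`
  have hbox : ∀ w : ℂ, lo₁ < w.re → w.re < hi₁ → lo₂ < w.im → w.im < hi₂ →
      w ∈ (polygonDomain l h).carrier := fun w h1 h2 h3 h4 ↦
    h.box_subset_of_mem_closure (ContinuousLinearEquiv.refl ℝ ℂ) hrect hfree₁ hfree₂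
      (show p ∈ _ from mem_reProdIm.2 ⟨⟨hlo₁, hhi₁⟩, ⟨hlo₂, hhi₂⟩⟩) (subset_closure hpP)
      (show w ∈ _ from mem_reProdIm.2 ⟨⟨h1, h2⟩, ⟨h3, h4⟩⟩)
  obtain ⟨a, ha1, ha2, ha3⟩ := exists_int_near hδ ht₁lo ht₁hi hw₁
  obtain ⟨b, hb1, hb2, hb3⟩ := exists_int_near hδ ht₂lo ht₂hi hw₂
  refine ⟨![a, b], mem_of_forall h hδ hF fun w hw0 hw0' hw1 hw1' ↦ subset_closure
    (hbox w ?_ ?_ ?_ ?_), ?_, ?_⟩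
  · simp only [Matrix.cons_val_zero] at hw0; linarith
  · simp only [Matrix.cons_val_zero] at hw0'; linarith
  · simp only [Matrix.cons_val_one, Matrix.cons_val_fin_one] at hw1; linarith
  · simp only [Matrix.cons_val_one, Matrix.cons_val_fin_one] at hw1'; linarith
  · simp only [Matrix.cons_val_zero]
    calc |δ * a - z.re| ≤ |δ * a - t₁| + |t₁ - z.re| := abs_sub_le _ _ _
      _ ≤ 3 * δ := by linarith
  · simp only [Matrix.cons_val_one, Matrix.cons_val_fin_one]
    calc |δ * b - z.im| ≤ |δ * b - t₂| + |t₂ - z.im| := abs_sub_le _ _ _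
      _ ≤ 3 * δ := by linarith

/-! ### Side-connectivity of `F` -/

omit h in
/-- Chains of side-adjacent `F`-squares can be reversed. [folklore] -/
theorem rtg_symm {a b : Site 2}
    (hab : Relation.ReflTransGen (fun a b : Site 2 ↦ a ∈ F ∧ b ∈ F ∧ (zdGraph 2).Adj a b) a b) :
    Relation.ReflTransGen (fun a b : Site 2 ↦ a ∈ F ∧ b ∈ F ∧ (zdGraph 2).Adj a b) b a := by
  induction hab with
  | refl => exact Relation.ReflTransGen.refl
  | tail _ hbc ih => exact Relation.ReflTransGen.head ⟨hbc.2.1, hbc.1, hbc.2.2.symm⟩ ih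

omit h in
/-- A straight run of `F`-squares is a chain of side-adjacent `F`-squares. [folklore] -/
theorem rtg_run (i : Fin 2) (s : Site 2) :
    ∀ n : ℕ, (∀ m : ℕ, m ≤ n → s + (m : ℤ) • (Pi.single i 1 : Site 2) ∈ F) →
      Relation.ReflTransGen (fun a b : Site 2 ↦ a ∈ F ∧ b ∈ F ∧ (zdGraph 2).Adj a b)
        s (s + (n : ℤ) • (Pi.single i 1 : Site 2))
  | 0, _ => by simpa using Relation.ReflTransGen.refl
  | n + 1, hall => by
    refine (rtg_run i s n fun m hm ↦ hall m (by omega)).tail ⟨hall n (by omega), ?_, ?_⟩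
    · exact_mod_cast hall (n + 1) le_rfl
    · rw [zdGraph_adj_iff]
      refine ⟨i, Or.inl ?_⟩
      push_cast
      rw [add_zsmul, one_zsmul, add_assoc]

include hrect hgre hδ hF in
/-- Two `F`-squares of a short row are joined through `F` along the row. [folklore] -/
theorem rtg_row {s s' : Site 2} (hs : s ∈ F) (hs' : s' ∈ F) (h1 : s' 1 = s 1) (h0 : s 0 ≤ s' 0)
    (hw : δ * ((s' 0 : ℝ) - s 0 + 1) < g) :
    Relation.ReflTransGen (fun a b : Site 2 ↦ a ∈ F ∧ b ∈ F ∧ (zdGraph 2).Adj a b) s s' := by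
  obtain ⟨n, hn⟩ : ∃ n : ℕ, s' 0 = s 0 + n := ⟨(s' 0 - s 0).toNat, by omega⟩
  have hs'eq : s' = s + (n : ℤ) • (Pi.single 0 1 : Site 2) := by
    funext i; fin_cases i <;> simp [Pi.add_apply, hn, h1]
  rw [hs'eq]
  refine rtg_run 0 s n fun m hm ↦ mem_of_row h hrect hgre hδ hF
    (t := s + (m : ℤ) • (Pi.single 0 1 : Site 2)) hs hs' h1 ?_ ?_ ?_ hw
  · simp [Pi.add_apply]
  · simp [Pi.add_apply]
  · simp only [Pi.add_apply, Pi.smul_apply, Pi.single_eq_same, smul_eq_mul, mul_one, hn]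
    omega

include hrect hgim hδ hF in
/-- Two `F`-squares of a short column are joined through `F` along the column. [folklore] -/
theorem rtg_col {s s' : Site 2} (hs : s ∈ F) (hs' : s' ∈ F) (h0 : s' 0 = s 0) (h1 : s 1 ≤ s' 1)
    (hw : δ * ((s' 1 : ℝ) - s 1 + 1) < g) :
    Relation.ReflTransGen (fun a b : Site 2 ↦ a ∈ F ∧ b ∈ F ∧ (zdGraph 2).Adj a b) s s' := by
  obtain ⟨n, hn⟩ : ∃ n : ℕ, s' 1 = s 1 + n := ⟨(s' 1 - s 1).toNat, by omega⟩
  have hs'eq : s' = s + (n : ℤ) • (Pi.single 1 1 : Site 2) := by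
    funext i; fin_cases i <;> simp [Pi.add_apply, hn, h0]
  rw [hs'eq]
  refine rtg_run 1 s n fun m hm ↦ mem_of_col h hrect hgim hδ hF
    (t := s + (m : ℤ) • (Pi.single 1 1 : Site 2)) hs hs' h0 ?_ ?_ ?_ hw
  · simp [Pi.add_apply]
  · simp [Pi.add_apply]
  · simp only [Pi.add_apply, Pi.smul_apply, Pi.single_eq_same, smul_eq_mul, mul_one, hn]
    omega

include hrect hgre hgim hδ hF in
/-- **Local connectivity.** Two `F`-squares at sup-distance `≤ R` with `δ (R + 2) < g` are
joined through `F` (along a row and a column through a corner square given by the corner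
lemmas). [folklore] -/
theorem joined_of_near (hg : 0 < g) {R : ℕ} (hR : δ * (R + 2) < g) {s s' : Site 2} (hs : s ∈ F)
    (hs' : s' ∈ F) (hd0 : |s 0 - s' 0| ≤ R) (hd1 : |s 1 - s' 1| ≤ R) :
    Relation.ReflTransGen (fun a b : Site 2 ↦ a ∈ F ∧ b ∈ F ∧ (zdGraph 2).Adj a b) s s' := by
  wlog hle : s 0 ≤ s' 0 generalizing s s' with H
  · exact rtg_symm (H hs' hs (by rwa [abs_sub_comm]) (by rwa [abs_sub_comm]) (le_of_not_ge hle))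
  obtain ⟨i0, i0'⟩ := abs_le.1 hd0
  obtain ⟨i1, i1'⟩ := abs_le.1 hd1
  have r0 : ((s' 0 : ℤ) : ℝ) - s 0 ≤ R := by exact_mod_cast (show s' 0 - s 0 ≤ (R : ℤ) by omega)
  have r1 : ((s' 1 : ℤ) : ℝ) - s 1 ≤ R := by exact_mod_cast (show s' 1 - s 1 ≤ (R : ℤ) by omega)
  have r1' : ((s 1 : ℤ) : ℝ) - s' 1 ≤ R := by exact_mod_cast (show s 1 - s' 1 ≤ (R : ℤ) by omega)
  have hδ' := hδ.le
  rcases lt_trichotomy (s 1) (s' 1) with hlt | heq | hgt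
  · rcases hle.lt_or_eq with h0lt | h0eq
    · rcases corner_mem_of_lt_of_lt h hrect hgre hgim hδ hF hg hs hs' h0lt hlt (by nlinarith)
        (by nlinarith) with hc | hc
      · exact (rtg_col h hrect hgim hδ hF hs hc (by simp) (by simp; omega)
          (by simp; nlinarith)).trans
          (rtg_row h hrect hgre hδ hF hc hs' (by simp) (by simp; omega) (by simp; nlinarith))
      · exact (rtg_row h hrect hgre hδ hF hs hc (by simp) (by simp; omega)
          (by simp; nlinarith)).trans
          (rtg_col h hrect hgim hδ hF hc hs' (by simp) (by simp; omega) (by simp; nlinarith))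
    · exact rtg_col h hrect hgim hδ hF hs hs' h0eq.symm hlt.le (by nlinarith)
  · exact rtg_row h hrect hgre hδ hF hs hs' heq.symm hle (by nlinarith)
  · rcases hle.lt_or_eq with h0lt | h0eq
    · rcases corner_mem_of_lt_of_gt h hrect hgre hgim hδ hF hg hs hs' h0lt hgt (by nlinarith)
        (by nlinarith) with hc | hc
      · exact (rtg_symm (rtg_col h hrect hgim hδ hF hc hs (by simp) (by simp; omega)
          (by simp; nlinarith))).trans
          (rtg_row h hrect hgre hδ hF hc hs' (by simp) (by simp; omega) (by simp; nlinarith))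
      · exact (rtg_row h hrect hgre hδ hF hs hc (by simp) (by simp; omega)
          (by simp; nlinarith)).trans
          (rtg_symm (rtg_col h hrect hgim hδ hF hs' hc (by simp) (by simp; omega)
            (by simp; nlinarith)))
    · exact rtg_symm (rtg_col h hrect hgim hδ hF hs' hs h0eq hgt.le (by nlinarith))

include hrect hgre hgim hδ hF in
/-- Chaining anchors along a walk of squares: if every square of a walk has an `F`-square at
sup-distance `≤ 4`, any `F`-squares `4`-close to its ends are joined through `F`
(`joined_of_near` with `R = 9`). [folklore] -/
theorem rtg_of_walk (hg : 0 < g) (hδg : 16 * δ < g) : ∀ {u v : Site 2} (ω : (zdGraph 2).Walk u v),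
    (∀ q ∈ ω.support, ∃ a ∈ F, |a 0 - q 0| ≤ 4 ∧ |a 1 - q 1| ≤ 4) →
    ∀ a ∈ F, |a 0 - u 0| ≤ 4 → |a 1 - u 1| ≤ 4 → ∀ b ∈ F, |b 0 - v 0| ≤ 4 → |b 1 - v 1| ≤ 4 →
      Relation.ReflTransGen (fun a b : Site 2 ↦ a ∈ F ∧ b ∈ F ∧ (zdGraph 2).Adj a b) a b
  | u, _, SimpleGraph.Walk.nil, _, a, ha, ha0, ha1, b, hb, hb0, hb1 => by
    refine joined_of_near h hrect hgre hgim hδ hF hg (R := 8) (by push_cast; linarith) ha hb ?_ ?_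
    · have e1 := abs_le.1 ha0; have e2 := abs_le.1 hb0; rw [abs_le]; push_cast; omega
    · have e1 := abs_le.1 ha1; have e2 := abs_le.1 hb1; rw [abs_le]; push_cast; omega
  | u, v, SimpleGraph.Walk.cons (v := w) hadj ω', hsupp, a, ha, ha0, ha1, b, hb, hb0, hb1 => by
    obtain ⟨a₁, ha₁, ha₁0, ha₁1⟩ := hsupp w (by simp)
    have h01 : ∀ i : Fin 2, |u i - w i| ≤ 1 := by
      intro i
      obtain ⟨j, hj | hj⟩ := (zdGraph_adj_iff u w).1 hadj
      · rw [hj]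
        by_cases hij : i = j
        · subst hij; simp
        · simp [Pi.add_apply, Pi.single_eq_of_ne hij]
      · rw [hj]
        by_cases hij : i = j
        · subst hij; simp
        · simp [Pi.add_apply, Pi.single_eq_of_ne hij]
    refine (joined_of_near h hrect hgre hgim hδ hF hg (R := 9) (by push_cast; linarith) ha ha₁
      ?_ ?_).trans (rtg_of_walk hg hδg ω' (fun q hq ↦ hsupp q (by simp [hq])) a₁ ha₁ ha₁0 ha₁1
        b hb hb0 hb1)
    · have e1 := abs_le.1 ha0; have e2 := abs_le.1 (h01 0); have e3 := abs_le.1 ha₁0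
      rw [abs_le]; push_cast; omega
    · have e1 := abs_le.1 ha1; have e2 := abs_le.1 (h01 1); have e3 := abs_le.1 ha₁1
      rw [abs_le]; push_cast; omega

include hrect hgre hgim hδ hF in
/-- **`F` is side-connected** (`16 δ < g`): join a point of `P` in the face of `s` to one in
the face of `t` by a path in `P` (open and connected), shadow it by a walk of squares each
containing a point of the path (`SquareTiling.exists_dualWalk_of_path`), attach to each an
`F`-square `3δ`-close to that point (`exists_mem_near`), and chain consecutive anchors through
`F` (`joined_of_near`). [folklore] -/
theorem connected (hg : 0 < g) (hδg : 16 * δ < g) {s t : Site 2} (hs : s ∈ F) (ht : t ∈ F) :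
    Relation.ReflTransGen (fun a b : Site 2 ↦ a ∈ F ∧ b ∈ F ∧ (zdGraph 2).Adj a b) s t := by
  have key : ∀ u ∈ F, ∃ z ∈ (polygonDomain l h).carrier, z ∈ SquareTiling.closedSq δ u := by
    intro u hu
    have hc : (⟨δ * (u 0 + 1 / 2), δ * (u 1 + 1 / 2)⟩ : ℂ) ∈ closure (polygonDomain l h).carrier :=
      memA_of_mem h hδ hF hu (by show _ ≤ δ * (u 0 + 1 / 2); linarith)
        (by show δ * (u 0 + 1 / 2) ≤ _; linarith) (by show _ ≤ δ * (u 1 + 1 / 2); linarith)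
        (by show δ * (u 1 + 1 / 2) ≤ _; linarith)
    obtain ⟨z, hz, hzd⟩ := Metric.mem_closure_iff.1 hc (δ / 2) (by positivity)
    refine ⟨z, hz, ?_⟩
    rw [Complex.dist_eq] at hzd
    have hre := abs_re_le_norm ((⟨δ * (u 0 + 1 / 2), δ * (u 1 + 1 / 2)⟩ : ℂ) - z)
    have him := abs_im_le_norm ((⟨δ * (u 0 + 1 / 2), δ * (u 1 + 1 / 2)⟩ : ℂ) - z)
    rw [sub_re] at hre
    rw [sub_im] at him
    have hre' := abs_le.1 (hre.trans hzd.le)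
    have him' := abs_le.1 (him.trans hzd.le)
    dsimp only at hre' him'
    exact ⟨by linarith, by linarith, by linarith, by linarith⟩
  obtain ⟨zs, hzs, hzsq⟩ := key s hs
  obtain ⟨zt, hzt, hztq⟩ := key t ht
  obtain ⟨γ, hγ⟩ := Literature.Topology.PlaneTopology.joinedIn_of_isPreconnected
    (polygonDomain l h).isOpen
    (polygonDomain l h).isConnected.isPreconnected subset_rfl hzs hzt
  obtain ⟨ω, -, hsupp⟩ := SquareTiling.exists_dualWalk_of_path hδ zero_le_one
    γ.continuous_extend.continuousOn (P := s) (P' := t) (by rwa [γ.extend_zero])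
    (by rwa [γ.extend_one])
  refine rtg_of_walk h hrect hgre hgim hδ hF hg hδg ω (fun q hq ↦ ?_) s hs (by simp) (by simp) t ht
    (by simp) (by simp)
  obtain ⟨τ, hτ, hqτ⟩ := hsupp q hq
  have hzA : γ.extend τ ∈ closure (polygonDomain l h).carrier :=
    subset_closure (by rw [Path.extend_apply γ hτ]; exact hγ _)
  obtain ⟨a, ha, ha0, ha1⟩ := exists_mem_near h hrect hgre hgim hδ hF hg hδg hzA
  obtain ⟨q0, q0', q1, q1'⟩ := hqτ
  obtain ⟨e0, e0'⟩ := abs_le.1 ha0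
  obtain ⟨e1, e1'⟩ := abs_le.1 ha1
  refine ⟨a, ha, ?_, ?_⟩
  · have r1 : ((a 0 : ℤ) : ℝ) - q 0 ≤ 4 :=
      le_of_mul_le_mul_left (by linarith : δ * ((a 0 : ℝ) - q 0) ≤ δ * 4) hδ
    have r2 : (-4 : ℝ) ≤ (a 0 : ℝ) - q 0 :=
      le_of_mul_le_mul_left (by linarith : δ * (-4 : ℝ) ≤ δ * ((a 0 : ℝ) - q 0)) hδ
    have i1 : a 0 - q 0 ≤ 4 := by exact_mod_cast r1
    have i2 : -4 ≤ a 0 - q 0 := by exact_mod_cast r2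
    rw [abs_le]; omega
  · have r1 : ((a 1 : ℤ) : ℝ) - q 1 ≤ 4 :=
      le_of_mul_le_mul_left (by linarith : δ * ((a 1 : ℝ) - q 1) ≤ δ * 4) hδ
    have r2 : (-4 : ℝ) ≤ (a 1 : ℝ) - q 1 :=
      le_of_mul_le_mul_left (by linarith : δ * (-4 : ℝ) ≤ δ * ((a 1 : ℝ) - q 1)) hδ
    have i1 : a 1 - q 1 ≤ 4 := by exact_mod_cast r1
    have i2 : -4 ≤ a 1 - q 1 := by exact_mod_cast r2
    rw [abs_le]; omega

/-! ### The packaged statement -/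

omit hrect hδ hF in
/-- **The polyomino of a rectilinear simple polygon at small mesh.** For a rectilinear simple
closed polygon `l` there is `δ₀ > 0` such that for every mesh `0 < δ < δ₀` the set `F` of unit
squares of `δℤ²` whose closed faces lie in `closure P` (`P = polygonDomain l h`) is nonempty,
hole-free and side-connected, its faces cover the points of `P` at distance `≥ 2δ` from `∂P`,
and the edge set `E` of all sides of its squares is induced, has no pinch vertex and no
diagonal contact, while every vertex of `E` with a missing lattice edge is `2δ`-close to `∂P`.
(`δ₀ = min (g / 16) (r₀ / 2)` for the grid gap `g` of the vertex coordinates and the radius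
`r₀` of a disc inside `P`.) [folklore] -/
theorem exists_mesh_polyomino (l : List ℂ) (h : IsSimpleClosedPolygon l)
    (hrect : ∀ (k : ℕ) (hk : k < l.length),
      (l[k]).re = (l[(k + 1) % l.length]'(Nat.mod_lt _ h.pos)).re ∨
      (l[k]).im = (l[(k + 1) % l.length]'(Nat.mod_lt _ h.pos)).im) :
    ∃ δ₀ : ℝ, 0 < δ₀ ∧ ∀ δ : ℝ, 0 < δ → δ < δ₀ → ∀ (F : Finset (Site 2)),
      (∀ s, s ∈ F ↔ closedSq δ s ⊆ closure (polygonDomain l h).carrier) →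
      F.Nonempty ∧ HoleFree (↑F : Set (Site 2)) ∧
      (∀ s ∈ F, ∀ t ∈ F, Relation.ReflTransGen
        (fun a b : Site 2 ↦ a ∈ F ∧ b ∈ F ∧ (zdGraph 2).Adj a b) s t) ∧
      (∀ z ∈ (polygonDomain l h).carrier,
        2 * δ ≤ infDist z (frontier (polygonDomain l h).carrier) → ∃ s ∈ F, z ∈ closedSq δ s) ∧
      ∀ (E : Finset (Sym2 (Site 2))),
        (∀ e, e ∈ E ↔ ∃ s ∈ F, ∃ j : Fin 4, e = s(corner s j, corner s j + dir j)) →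
        (∀ x ∈ verts E, ∀ k : Fin 4, x + dir k ∈ verts E → s(x, x + dir k) ∈ E) ∧
        (∀ x ∈ verts E, ∀ k : Fin 4, InF E (quad x k) → InF E (quad x (k + 2)) →
          InF E (quad x (k + 1)) ∨ InF E (quad x (k + 3))) ∧
        (∀ x ∈ verts E, ∀ k : Fin 4, x + dir k + dir (k + 1) ∈ verts E →
          x + dir k ∈ verts E ∨ x + dir (k + 1) ∈ verts E) ∧
        (∀ x ∈ verts E, (∃ k : Fin 4, s(x, x + dir k) ∉ E) →
          infDist (meshPoint δ x) (frontier (polygonDomain l h).carrier) ≤ 2 * δ) := by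
  obtain ⟨g, hg, hgre, hgim⟩ := exists_grid_gap l
  obtain ⟨z₀, hz₀⟩ := (polygonDomain l h).nonempty
  obtain ⟨r₀, hr₀, hball⟩ := Metric.isOpen_iff.1 (polygonDomain l h).isOpen z₀ hz₀
  refine ⟨min (g / 16) (r₀ / 2), by positivity, fun δ hδ hδ₀ F hF ↦ ?_⟩
  have hδg : 16 * δ < g := by have := min_le_left (g / 16) (r₀ / 2); linarith
  have hδr : 2 * δ < r₀ := by have := min_le_right (g / 16) (r₀ / 2); linarith
  have hg4 : 4 * δ < g := by linarith
  refine ⟨?_, holeFree h hδ hF, fun s hs t ht ↦ connected h hrect hgre hgim hδ hF hg hδg hs ht,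
    fun z hz hd ↦ exists_mem_closedSq h hδ hF hz hd, fun E hE ↦ ⟨?_, ?_, ?_, ?_⟩⟩
  · have hne : (frontier (polygonDomain l h).carrier).Nonempty :=
      ⟨_, h.getElem_mem_frontier h.pos⟩
    have hd : 2 * δ ≤ infDist z₀ (frontier (polygonDomain l h).carrier) := by
      rw [le_infDist hne]
      intro f hf
      by_contra hlt
      push Not at hlt
      have hfb : f ∈ ball z₀ r₀ := mem_ball'.2 (by linarith)
      have : f ∈ (polygonDomain l h).carrier ∩ frontier (polygonDomain l h).carrier :=
        ⟨hball hfb, hf⟩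
      rw [(polygonDomain l h).isOpen.inter_frontier_eq] at this
      exact this
    obtain ⟨s, hs, -⟩ := exists_mem_closedSq h hδ hF hz₀ hd
    exact ⟨s, hs⟩
  · exact fun x hx k hy ↦ induced h hrect hgre hgim hδ hF hE hg hg4 hx k hy
  · exact fun x _ k h1 h2 ↦ noPinch h hrect hgre hgim hδ hF hE hg hg4 k h1 h2
  · exact fun x hx k hz ↦ noDiagonal h hrect hgre hgim hδ hF hE hg hg4 hx k hz
  · exact fun x hx hk ↦ infDist_meshPoint_le h hδ hF hE hx hk

end RectilinearPolyomino

end Literature.Probability.LatticeModels
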